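import Mathlib
import Literature.Probability.Percolation.SitePercolationMeasure
import Literature.Analysis.FunctionSpaces.PoissonPointProcess
import Literature.Analysis.FunctionSpaces.PoissonMecke

/-!
# Stub `stub_smallCells` (K0), Part 1 — line `Sketch`, crux `SquareFromVoronoiHub`
# (stmt-CriticalPhenomena-6434): the total-variation lemma and Poisson helpers

Support file for the K0 stub "cells of scale `δ²` ARE site percolation" of the line skeleton
`Cruxes/SquareFromVoronoiHub/Lines/Sketch.lean`.  Two reusable, model-free pieces:

* `abs_real_sub_sitePercolation_half_le` — **the TV lemma**: if a random site configuration
  `X : Ω → Set V` under a probability law `μ` admits, for every colour pattern `y` on a finite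
  set of sites `F`, a measurable event `G y ⊆ {X agrees with y on F}` of probability at least
  `(q/2)^{|F|}` (`0 ≤ q ≤ 1`), then for every event `E` determined by `F`,
  `|μ(X ∈ E) - P_{1/2}(E)| ≤ 1 - q^{|F|}`.  (Elementary: the `2^{|F|}` events `G y` are pairwise
  disjoint, those with `y ∈ E` lie inside `{X ∈ E}`, the others inside its complement; no
  measurability of `X` is needed.)
* Poisson helpers on `PointConfig`: `count_ne_zero_iff`, `count_eq_zero_iff`, the real volume of
  a disc `volume.real (ball a r) = π r²`, and `measure_count_univ_eq_zero`: under a Poisson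
  process of Lebesgue intensity on `ℂ` the empty configuration is a null event (it is void in
  every disc `B(0,n)`, an event of probability `e^{-π n²}`).

References: B. Bollobás, O. Riordan, *Percolation* (CUP 2006), Ch. 8 §8.3 (discrete
approximations to random Voronoi percolation); G. Grimmett, *Percolation* (1999), §2.2 (cylinder
events); J. F. C. Kingman, *Poisson Processes* (1993), §2.1.
-/

noncomputable section

open scoped Topology MeasureTheory ENNReal
open Filter Set MeasureTheory

namespace Summit.CriticalPhenomena.CardyFormulaZ2.Cruxes.SquareFromVoronoiHub.VoronoiBlocks.SmallCells

open Literature.Probability.Percolation (SiteConfig sitePercolation half DeterminedBy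
  determinedBy_iff traceEvent liftSiteConfig siteWeight sitePercolation_real_eq_sum bernoulliProp)
open Literature.Analysis.FunctionSpaces (PointConfig IsPoissonPointProcess)

/-! ### Site percolation at `1/2`: the uniform law on patterns -/

/-- At `p = 1/2` every pattern on the finite set of sites `F` has weight `2^{-|F|}`. [folklore] -/
theorem siteWeight_half {V : Type*} {F : Finset V} (y : ↥F → Prop) :
    siteWeight half y = (1 / 2 : ℝ) ^ F.card := by
  unfold siteWeight
  have h : ∀ i : ↥F, (bernoulliProp half).real {y i} = 1 / 2 := by
    intro i
    by_cases hy : y i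
    · rw [eq_true hy, Literature.Probability.Percolation.bernoulliProp_real_true]
      simp
    · rw [eq_false hy, Literature.Probability.Percolation.bernoulliProp_real_false]
      simp only [Literature.Probability.Percolation.coe_half]
      norm_num
  simp only [h, Finset.prod_const, Finset.card_univ, Fintype.card_coe]

open Classical in
/-- `P_{1/2}(E) = #{patterns on F lying in E} · 2^{-|F|}` for an event `E` determined by the
finite set of sites `F` (Grimmett 1999, §2.2, cylinder events). [folklore] -/
theorem sitePercolation_half_real_eq {V : Type*} {F : Finset V} {E : Set (SiteConfig V)}
    (hE : DeterminedBy E ↑F) :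
    (sitePercolation V half).real E =
      ((Finset.univ.filter fun y : ↥F → Prop => y ∈ traceEvent F E).card : ℝ) *
        (1 / 2) ^ F.card := by
  rw [sitePercolation_real_eq_sum half hE]
  simp only [siteWeight_half, Finset.sum_const, nsmul_eq_mul]

open Classical in
/-- **The total-variation lemma.** Let `X : Ω → Set V` be any random site configuration under a
probability law `μ`, `F` a finite set of sites and `E` an event determined by `F`. Suppose every
colour pattern `y` on `F` carries a measurable event `G y` on which `X` agrees with `y` on `F`,
of probability at least `(q/2)^{|F|}` with `0 ≤ q ≤ 1`. Then
`|μ {X ∈ E} - P_{1/2}(E)| ≤ 1 - q^{|F|}`: the `G y` are pairwise disjoint, `⋃_{y ∈ E} G y ⊆ {X ∈ E}`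
and `{X ∈ E} ⊆ (⋃_{y ∉ E} G y)ᶜ`, while `P_{1/2}(E) = #{y ∈ E} 2^{-|F|}`.  (The comparison step
of Bollobás–Riordan 2006, Ch. 8 §8.3, in abstract form; no measurability of `X` is used.)
[folklore] -/
theorem abs_real_sub_sitePercolation_half_le {Ω V : Type*} [MeasurableSpace Ω] (μ : Measure Ω)
    [IsProbabilityMeasure μ] (X : Ω → SiteConfig V) (F : Finset V) {E : Set (SiteConfig V)}
    (hE : DeterminedBy E ↑F) (G : (↥F → Prop) → Set Ω) (hGm : ∀ y, MeasurableSet (G y))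
    (hGX : ∀ y, ∀ ω ∈ G y, ∀ i : ↥F, ((i : V) ∈ X ω ↔ y i)) {q : ℝ} (hq0 : 0 ≤ q)
    (hq1 : q ≤ 1) (hG : ∀ y, (q / 2) ^ F.card ≤ μ.real (G y)) :
    |μ.real {ω | X ω ∈ E} - (sitePercolation V half).real E| ≤ 1 - q ^ F.card := by
  set n := F.card with hn
  set T := Finset.univ.filter fun y : ↥F → Prop => y ∈ traceEvent F E with hT
  set m : ℝ := (T.card : ℝ) with hm
  have hsite : (sitePercolation V half).real E = m * (1 / 2) ^ n :=
    sitePercolation_half_real_eq hE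
  -- on `G y`, `X ∈ E` iff the pattern `y` lies in `E`
  have hdet : ∀ y, ∀ ω ∈ G y, (X ω ∈ E ↔ y ∈ traceEvent F E) := by
    intro y ω hω
    have hE' := (determinedBy_iff E ↑F).1 hE
    refine hE' (X ω) {v | liftSiteConfig F y v} ?_
    ext v
    simp only [Set.mem_inter_iff, Set.mem_setOf_eq, Finset.mem_coe, liftSiteConfig]
    constructor
    · rintro ⟨hv, hvF⟩
      exact ⟨⟨hvF, (hGX y ω hω ⟨v, hvF⟩).1 hv⟩, hvF⟩
    · rintro ⟨⟨hvF', h⟩, hvF⟩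
      exact ⟨(hGX y ω hω ⟨v, hvF'⟩).2 h, hvF⟩
  -- the events `G y` are pairwise disjoint
  have hdisj : Pairwise (Function.onFun Disjoint G) := by
    intro y y' hne
    rw [Function.onFun, Set.disjoint_left]
    intro ω h h'
    apply hne
    funext i
    exact propext ((hGX y ω h i).symm.trans (hGX y' ω h' i))
  have hdisjT : ∀ S : Finset (↥F → Prop), Set.PairwiseDisjoint (↑S : Set (↥F → Prop)) G :=
    fun S y _ y' _ h => hdisj h
  -- cardinalities
  have hcardU : (Fintype.card (↥F → Prop) : ℝ) = 2 ^ n := by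
    rw [Fintype.card_fun, Fintype.card_prop, Fintype.card_coe]
    push_cast
    rfl
  have hm0 : 0 ≤ m := by positivity
  have hmle : m ≤ 2 ^ n := by
    rw [← hcardU, hm]
    exact_mod_cast T.card_le_univ
  have hmc : ((Tᶜ.card : ℕ) : ℝ) = 2 ^ n - m := by
    rw [Finset.card_compl, Nat.cast_sub T.card_le_univ, hcardU]
  -- lower bound
  have hlow : m * (q / 2) ^ n ≤ μ.real {ω | X ω ∈ E} := by
    calc m * (q / 2) ^ n = ∑ y ∈ T, (q / 2) ^ n := by rw [Finset.sum_const, nsmul_eq_mul]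
      _ ≤ ∑ y ∈ T, μ.real (G y) := Finset.sum_le_sum fun y _ => hG y
      _ = μ.real (⋃ y ∈ T, G y) :=
          (measureReal_biUnion_finset (hdisjT T) (fun y _ => hGm y)).symm
      _ ≤ μ.real {ω | X ω ∈ E} := by
          refine measureReal_mono ?_
          intro ω hω
          simp only [Set.mem_iUnion, exists_prop] at hω
          obtain ⟨y, hy, hω⟩ := hω
          exact (hdet y ω hω).2 (Finset.mem_filter.1 hy).2
  -- upper bound
  have hup : μ.real {ω | X ω ∈ E} ≤ 1 - (2 ^ n - m) * (q / 2) ^ n := by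
    have hsub : {ω | X ω ∈ E} ⊆ (⋃ y ∈ Tᶜ, G y)ᶜ := by
      intro ω hω hω'
      simp only [Set.mem_iUnion, exists_prop] at hω'
      obtain ⟨y, hy, hω'⟩ := hω'
      rw [Finset.mem_compl, Finset.mem_filter] at hy
      exact hy ⟨Finset.mem_univ _, (hdet y ω hω').1 hω⟩
    calc μ.real {ω | X ω ∈ E} ≤ μ.real (⋃ y ∈ Tᶜ, G y)ᶜ := measureReal_mono hsub
      _ = 1 - μ.real (⋃ y ∈ Tᶜ, G y) :=
          probReal_compl_eq_one_sub (Finset.measurableSet_biUnion _ fun y _ => hGm y)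
      _ = 1 - ∑ y ∈ Tᶜ, μ.real (G y) := by
          rw [measureReal_biUnion_finset (hdisjT Tᶜ) (fun y _ => hGm y)]
      _ ≤ 1 - ∑ y ∈ Tᶜ, (q / 2) ^ n := by
          gcongr with y _
          exact hG y
      _ = 1 - (2 ^ n - m) * (q / 2) ^ n := by
          rw [Finset.sum_const, nsmul_eq_mul, hmc]
  -- bookkeeping
  have h2t : (2 : ℝ) ^ n * (q / 2) ^ n = q ^ n := by
    rw [← mul_pow]
    congr 1
    ring
  have h2t' : (2 : ℝ) ^ n * (1 / 2) ^ n = 1 := by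
    rw [← mul_pow]
    norm_num
  have ht_le : (q / 2) ^ n ≤ (1 / 2) ^ n :=
    pow_le_pow_left₀ (by positivity) (by linarith) n
  have hmt : m * (q / 2) ^ n ≤ m * (1 / 2) ^ n := mul_le_mul_of_nonneg_left ht_le hm0
  have hmt' : m * ((1 / 2) ^ n - (q / 2) ^ n) ≤ 2 ^ n * ((1 / 2) ^ n - (q / 2) ^ n) :=
    mul_le_mul_of_nonneg_right hmle (sub_nonneg.2 ht_le)
  rw [hsite, abs_sub_le_iff]
  constructor
  · nlinarith [hup, hmt, h2t]
  · nlinarith [hlow, hmt', h2t, h2t']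

/-! ### Poisson point configurations: counting helpers -/

section Count

variable {E : Type*} [TopologicalSpace E]

/-- A configuration has a point in `s` iff `N(s) ≠ 0`. [folklore] -/
theorem count_ne_zero_iff (c : PointConfig E) (s : Set E) :
    c.count s ≠ 0 ↔ ∃ z ∈ c, z ∈ s := by
  rw [PointConfig.count, Set.encard_ne_zero]
  exact ⟨fun ⟨z, hz, hzs⟩ => ⟨z, hz, hzs⟩, fun ⟨z, hz, hzs⟩ => ⟨z, hz, hzs⟩⟩

/-- A configuration has no point in `s` iff `N(s) = 0`. [folklore] -/
theorem count_eq_zero_iff (c : PointConfig E) (s : Set E) :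
    c.count s = 0 ↔ ∀ z ∈ c, z ∉ s := by
  have h := not_congr (count_ne_zero_iff c s)
  push Not at h
  exact h

/-- A configuration is empty iff `N(univ) = 0`. [folklore] -/
theorem count_univ_eq_zero_iff (c : PointConfig E) :
    c.count Set.univ = 0 ↔ (c : Set E) = ∅ := by
  rw [count_eq_zero_iff, Set.eq_empty_iff_forall_notMem]
  simp

end Count

/-! ### Lebesgue measure of discs and the null event "no nucleus at all" -/

/-- The area of a disc: `volume.real (ball a r) = π r²` for `r ≥ 0`. [folklore] -/
theorem volume_real_ball (a : ℂ) {r : ℝ} (hr : 0 ≤ r) :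
    volume.real (Metric.ball a r) = Real.pi * r ^ 2 := by
  rw [measureReal_def, Complex.volume_ball, ENNReal.toReal_mul, ENNReal.toReal_pow,
    ENNReal.toReal_ofReal hr, ENNReal.coe_toReal, NNReal.coe_real_pi, mul_comm]

/-- The area of a disc is finite. [folklore] -/
theorem volume_ball_ne_top (a : ℂ) (r : ℝ) : volume (Metric.ball a r) ≠ ∞ :=
  measure_ball_lt_top.ne

/-- **The empty configuration is a null event** for a Poisson process of Lebesgue intensity on
`ℂ`: `{c = ∅} ⊆ {N(B(0,n)) = 0}`, an event of probability `e^{-π n²} ≤ e^{-n}` for every `n ≥ 1`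
(Kingman 1993, §2.1, void probabilities). [folklore] -/
theorem measure_count_univ_eq_zero {P : Measure (PointConfig ℂ)}
    (hP : IsPoissonPointProcess (volume : Measure ℂ) P) :
    P {c | c.count Set.univ = 0} = 0 := by
  haveI := hP.isProbabilityMeasure
  have hle : ∀ n : ℕ, P.real {c | c.count Set.univ = 0} ≤ Real.exp (-(n : ℝ)) := by
    intro n
    have hvol : (n : ℝ) ≤ (volume (Metric.ball (0 : ℂ) n)).toReal := by
      rw [← measureReal_def, volume_real_ball 0 (Nat.cast_nonneg n)]
      rcases Nat.eq_zero_or_pos n with h0 | hpos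
      · simp [h0]
      · have h1 : (1 : ℝ) ≤ n := by exact_mod_cast hpos
        nlinarith [Real.pi_gt_three]
    calc P.real {c | c.count Set.univ = 0}
        ≤ P.real {c | c.count (Metric.ball (0 : ℂ) n) = 0} := by
          refine measureReal_mono fun c hc => ?_
          simp only [Set.mem_setOf_eq] at hc ⊢
          exact nonpos_iff_eq_zero.1 (hc ▸ c.count_mono (Set.subset_univ _))
      _ = Real.exp (-(volume (Metric.ball (0 : ℂ) n)).toReal) :=
          hP.measureReal_count_eq_zero Metric.isOpen_ball.measurableSet (volume_ball_ne_top 0 n)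
      _ ≤ Real.exp (-(n : ℝ)) := Real.exp_le_exp.2 (neg_le_neg hvol)
  have h0 : P.real {c | c.count Set.univ = 0} ≤ 0 :=
    le_of_tendsto_of_tendsto' tendsto_const_nhds
      (Real.tendsto_exp_neg_atTop_nhds_zero.comp tendsto_natCast_atTop_atTop) hle
  have h1 : P.real {c | c.count Set.univ = 0} = 0 := le_antisymm h0 measureReal_nonneg
  exact (measureReal_eq_zero_iff (measure_ne_top P _)).1 h1

/-- Under a product of two Poisson laws of Lebesgue intensity on `ℂ`, the event that the FIRST
configuration is empty is null. [folklore] -/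
theorem prod_measure_fst_empty_eq_zero {P₁ P₂ : Measure (PointConfig ℂ)}
    (h₁ : IsPoissonPointProcess (volume : Measure ℂ) P₁) [SFinite P₂] :
    (P₁.prod P₂) {c | c.1.count Set.univ = 0} = 0 := by
  have : {c : PointConfig ℂ × PointConfig ℂ | c.1.count Set.univ = 0} =
      {c : PointConfig ℂ | c.count Set.univ = 0} ×ˢ Set.univ := by
    ext c; simp
  rw [this, Measure.prod_prod, measure_count_univ_eq_zero h₁, zero_mul]

/-- Under a product of two Poisson laws of Lebesgue intensity on `ℂ`, the event that the SECOND
configuration is empty is null. [folklore] -/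
theorem prod_measure_snd_empty_eq_zero {P₁ P₂ : Measure (PointConfig ℂ)}
    (h₂ : IsPoissonPointProcess (volume : Measure ℂ) P₂) [SFinite P₁] :
    (P₁.prod P₂) {c | c.2.count Set.univ = 0} = 0 := by
  haveI := h₂.isProbabilityMeasure
  have : {c : PointConfig ℂ × PointConfig ℂ | c.2.count Set.univ = 0} =
      (Set.univ : Set (PointConfig ℂ)) ×ˢ {c : PointConfig ℂ | c.count Set.univ = 0} := by
    ext c; simp
  rw [this, Measure.prod_prod, measure_count_univ_eq_zero h₂, mul_zero]

/-- The event "both configurations are non-empty" is CO-NULL under a product of Poisson laws of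
Lebesgue intensity, so intersecting with it does not change probabilities. [folklore] -/
theorem prod_measure_inter_nonempty {P₁ P₂ : Measure (PointConfig ℂ)}
    (h₁ : IsPoissonPointProcess (volume : Measure ℂ) P₁)
    (h₂ : IsPoissonPointProcess (volume : Measure ℂ) P₂) (S : Set (PointConfig ℂ × PointConfig ℂ)) :
    (P₁.prod P₂) (S ∩ {c | c.1.count Set.univ ≠ 0 ∧ c.2.count Set.univ ≠ 0}) = (P₁.prod P₂) S := by
  haveI := h₁.isProbabilityMeasure
  haveI := h₂.isProbabilityMeasure
  refine measure_inter_conull ?_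
  have : {c : PointConfig ℂ × PointConfig ℂ | c.1.count Set.univ ≠ 0 ∧ c.2.count Set.univ ≠ 0}ᶜ =
      {c | c.1.count Set.univ = 0} ∪ {c | c.2.count Set.univ = 0} := by
    ext c
    simp only [Set.mem_compl_iff, Set.mem_setOf_eq, not_and_or, not_not, Set.mem_union]
  rw [this]
  exact measure_union_null (prod_measure_fst_empty_eq_zero h₁) (prod_measure_snd_empty_eq_zero h₂)

/-! ### Registered sub-goal of the stub (Part 1) -/

/-- **Part 1 of stub `stub_smallCells`, registered sub-goal** (`--supports stmt-CriticalPhenomena-6434`):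
the TV lemma `abs_real_sub_sitePercolation_half_le` as a closed statement. [folklore] -/
theorem stub_smallCells_part1 : ∀ {Ω V : Type*} [MeasurableSpace Ω] (μ : Measure Ω)
    [IsProbabilityMeasure μ] (X : Ω → SiteConfig V) (F : Finset V) {E : Set (SiteConfig V)},
    DeterminedBy E ↑F → ∀ (G : (↥F → Prop) → Set Ω), (∀ y, MeasurableSet (G y)) →
    (∀ y, ∀ ω ∈ G y, ∀ i : ↥F, ((i : V) ∈ X ω ↔ y i)) → ∀ {q : ℝ}, 0 ≤ q → q ≤ 1 →
    (∀ y, (q / 2) ^ F.card ≤ μ.real (G y)) →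
    |μ.real {ω | X ω ∈ E} - (sitePercolation V half).real E| ≤ 1 - q ^ F.card := by
  intro Ω V _ μ _ X F E hE G hGm hGX q hq0 hq1 hG
  exact abs_real_sub_sitePercolation_half_le μ X F hE G hGm hGX hq0 hq1 hG

end Summit.CriticalPhenomena.CardyFormulaZ2.Cruxes.SquareFromVoronoiHub.VoronoiBlocks.SmallCells

end
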